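import Literature.AlgebraicGeometry.Milne1999.SpecialLefschetzGroupInvariantsRealMultiplication
import Mathlib.LinearAlgebra.Dual.Lemmas
import Mathlib.LinearAlgebra.FiniteDimensional.Lemmas
import HarnessLib

/-!
# Milne 1999, Theorem 3.2 / Corollary 4.5 for one generator with a Rosati partner: the `S(A)`-invariants
# of a complex abelian variety whose `C(A) ⊗ ℂ` is the commutant of one diagonalisable `φ^*` whose
# `Q_h`-adjoint lies in the double commutant are the Lefschetz classes (mixed symplectic and
# general-linear blocks, `S(A)(ℂ) = ∏_{ν = ν̄} Sp(H_ν) × ∏_{{ν, ν̄}} GL(H_ν)`)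

Family `hodge`, layer `Literature/AlgebraicGeometry/Milne1999`, namespace
`Literature.AlgebraicGeometry.Milne1999` (D-0022). THEOREMS ONLY (no definition, no named fact; D-0026).
Written for the cell `pub-hodgecm2` (COR-CM), seat `lit-milne`, binder table `HOME/lit/milne.md` rows
M2/M4, as the common generalisation of `Milne1999/SpecialLefschetzGroupInvariantsSymplectic` (`φ^*`
scalar: one symplectic block), `Milne1999/SpecialLefschetzGroupInvariantsImaginaryQuadratic` (one
general-linear block) and `Milne1999/SpecialLefschetzGroupInvariantsRealMultiplication` (`φ^*`
self-adjoint: several symplectic blocks). The cited record `Milne1999_specialLefschetzGroup_invariants_le`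
of `Milne1999/LefschetzGroup` (Cor. 4.5 with Thm. 4.4 and Thm. 3.2: for EVERY complex abelian variety, the
classes of `H²ᵖ(A(ℂ); ℂ)` fixed by `specialLefschetzGroup (dim A) A.X` lie in `Dᵖ_hom(A)_ℂ`) rests, for
a general `A`, on the first fundamental theorem of invariant theory over the factors of `C(A)`
(Prop. 3.6). This file PROVES its conclusion for the abelian varieties `A` carrying an endomorphism `φ`
and a polarization class `h` such that

* `φ^*` is diagonalisable on `H¹(A(ℂ); ℂ)` (`⨆_μ ker(φ^* - μ) = H¹`),
* `C(A) ⊗ ℂ` is the commutant of `φ^*` alone (`centralizerAlgebra A = Subalgebra.centralizer ℂ {φ^*}`),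
* the `Q_h`-adjoint of `φ^*` is an operator `J'` commuting with `C(A) ⊗ ℂ`
  (`Q_h(φ^*x, y) = Q_h(x, J'y)`, `J' ∈ Subalgebra.centralizer ℂ (centralizerAlgebra A)`) — e.g.
  `J' = ψ^*` for `ψ = φ† ∈ End(A)` the Rosati conjugate of `φ` (`_of_rosati` corollaries), so
  `J' = φ^*` for a simple abelian variety of TYPE I (`End⁰(A) = F = ℚ(φ)` totally real, Rosati
  involution trivial on `F`) and `J' = φ̄^*` for TYPE IV with commutative `End⁰(A) = K = ℚ(φ)` a
  CM field (Rosati involution = complex conjugation on `K`):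

* **`mem_divisorClassesSpan_of_forall_exteriorPullback_eq_of_adjoint`** — Prop. 3.6 (a) and (c) (`r = 1`)
  in every block, glued (p. 656): every class of `H²ᵖ(A(ℂ); ℂ)` fixed by `⋀²ᵖu` for all
  `u ∈ S(A)(ℂ) = unitaryCentralizerGroup A h` lies in `Dᵖ(A) ⊗ ℂ = divisorClassesSpan A.X (dim A) p`.
* **`specialLefschetzGroup_invariants_le_of_adjoint`** — the conclusion of the record
  `Milne1999_specialLefschetzGroup_invariants_le` for such `A` (`⋀•u ∈ specialLefschetzGroup` for
  `u ∈ S(A)(ℂ)`, `exteriorPullbackEquiv_mem_specialLefschetzGroup`, Thm. 4.4);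
  `setOf_forall_apply_eq_self_eq_divisorClassesSpan_of_adjoint` (Cor. 4.5 as an equality of sets);
  `isDivisorGenerated_of_hodgeGroup_eq_specialLefschetzGroup_of_adjoint` (Prop. 4.8 (c) ⇒ (a) on `A`);
  `specialLefschetzGroup_invariants_le_of_rosati`, `isDivisorGenerated_of_hodgeGroup_eq_specialLefschetzGroup_of_rosati`
  (`J' = ψ^*`, `ψ ∈ End(A)`).

## The structure of `S(A)(ℂ)` for one generator (Milne §2, types I and IV with `d = 1`)

* **`exists_forall_mem_eigenspace_apply_eq_smul`** — an operator in the double commutant of a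
  diagonalisable `J` is a scalar `c(ν)` on each eigenspace `V_ν(J)` (the centre of
  `C(A) ⊗ ℂ = ∏_ν End(V_ν)` is `∏_ν ℂ`); so `Q_h(V_μ, V_ν) = 0` unless `μ = c(ν)`
  (`apply_eq_zero_of_mem_eigenspace_of_apply_eq_smul`).
* **`eigenspace_ne_bot_and_apply_apply_eq`** — `ν ↦ ν̄ := c(ν)` is an involution of the spectrum of `J`
  (non-degeneracy): the blocks are the orbits `{ν, ν̄}`; `ν̄ = ν` gives a symplectic block
  (`Q_h|V_ν` non-degenerate), `ν̄ ≠ ν` a general-linear block (`V_ν`, `V_ν̄` isotropic, perfectly paired: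
  `V_ν̄ ≅ V_ν^∨`, "the standard representation and its contragredient", p. 650).
* **`exists_pairedFamilies`**, **`exists_blockBasis_of_orthogonality`** — a basis `(e^k_i, f^k_i)` of `H¹`
  with `e^k_i ∈ V_{ν_k}`, `f^k_i ∈ V_{ν̄_k}`, symplectic relations in each block and `Q_h = 0` across
  blocks (symplectic bases, McDuff–Salamon Thm. 2.1.3, in the symplectic blocks; a basis and its dual
  basis in the general-linear ones).

With this basis the proof of `Milne1999/SpecialLefschetzGroupInvariantsRealMultiplication` runs
verbatim (its engine, word products and non-vanishing are imported): the block torus and the block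
permutations commute with `φ^*` (they preserve every `V_ν`) and preserve `Q_h`, so they lie in
`S(A)(ℂ)`; the block projector `e_k` onto `V_{ν_k} ⊕ V_{ν̄_k}` is the Lagrange interpolation
polynomial of the indicator of `{ν_k, ν̄_k}` evaluated at `φ^*` (`exists_polynomial_blockProjector`), so
`ω_k = ⋀²e_k h ∈ B¹ ⊗ ℂ`, `h = Σ_k ω_k`, and the symmetric word products of the `ω_k` exhaust the
invariants. NOT Milne's road (the first fundamental theorem for `Sp` and `GL`, Prop. 3.6 (a), (c),
Fulton–Harris F.13/F.20): weights of the diagonal torus and the Weyl group instead, `r = 1` only.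

NOT here: several generators (types II/III: `E` a quaternion algebra; type IV with `d ≥ 2`), powers
`A^r` (`r ≥ 2`), the positivity statement that the Rosati involution of EVERY polarization induces
complex conjugation on a CM subfield / the identity on a totally real subfield (the adjoint `J'` is
DATA here) — the record stays cited for those.

## References

* [Milne1999LefschetzClasses] J. S. Milne, Lefschetz classes on abelian varieties, Duke Math. J. 96
  (1999) 639–675: §1 p. 644, §2 pp. 645–650 (types I and IV: `S(A)_{k^{al}} ≅ ∏_σ Sp(φ_σ)`, resp.
  `S_σ ≈ GL_{g/f}(k^{al})`, "the direct sum of `d` copies of the standard representation and `d` copies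
  of its contragredient"), Lemma 3.1, Thm. 3.2, Props. 3.3–3.4, 3.6 (a), (c) (pp. 652–656), p. 656
  ("Completion of the proof of Prop. 3.4"), Thm. 4.4, Cor. 4.5 (p. 659), Prop. 4.8 (p. 660).
* [FultonHarris1991] W. Fulton, J. Harris, Representation Theory. A First Course, GTM 129 (1991): §15.1,
  §16.1 (weights of `GL_n`, `Sp_{2n}`, Weyl groups), App. F.13, F.20.
* [McDuffSalamon2017] D. McDuff, D. Salamon, Introduction to Symplectic Topology, 3rd ed. (2017),
  Thm. 2.1.3 (symplectic bases).
* [vanGeemen1994HodgeAV] B. van Geemen, An introduction to the Hodge conjecture for abelian varieties,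
  LNM 1594 (1994), §2.4 (`Dᵖ`), 4.8, §6 (abelian varieties of Weil type: `K ⊂ End⁰(A)`, `H¹ ⊗ ℂ =
  W ⊕ W̄`).
* [VoisinHodgeI2002] C. Voisin, Hodge Theory and Complex Algebraic Geometry I (2002), §3.1.3 Cor. 3.9,
  §7.1.2.
* [LangeBirkenhake1992] H. Lange, Ch. Birkenhake, Complex Abelian Varieties (1992), §5.1 (Rosati
  involution), Thm. 5.5.3/5.5.6 (types I–IV).
-/

noncomputable section

open CategoryTheory Polynomial
open Literature.AlgebraicTopology.SingularHomology
open Literature.AlgebraicGeometry.HodgeTheory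
open Literature.AlgebraicGeometry.Motives
open Literature.AlgebraicGeometry.VanGeemen1994 (pullbackOne hodgeClassSpan)
open Literature.AlgebraicGeometry.Pohlmann1968 (exists_monomialBasis)
open Literature.Barriers.HodgeConjecture (divisorClassesSpan divisorMonomials mem_divisorMonomials_zero)
open Literature.Geometry.Kaehler (lefschetzPow)

namespace Literature.AlgebraicGeometry.Milne1999

/-! ### §1 Linear algebra: eigenvalue pairing by an adjoint pair and the adapted block basis -/
section AdjointPair

variable {V : Type*} [AddCommGroup V] [Module ℂ V]

/-- If `B(Jx, y) = B(x, J'y)` and `J' y = c y`, then an eigenvector `x` of `J` for an eigenvalue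
`μ ≠ c` is `B`-orthogonal to `y` ("`φ(αx, y) = φ(x, α†y)`", Milne §2 p. 649).
[cite: Milne1999LefschetzClasses, §2 pp. 647–649] -/
theorem apply_eq_zero_of_mem_eigenspace_of_apply_eq_smul (B : LinearMap.BilinForm ℂ V)
    (J J' : Module.End ℂ V) (hadj : ∀ x y, B (J x) y = B x (J' y)) {μ c : ℂ} (hμc : μ ≠ c) {x y : V}
    (hx : x ∈ J.eigenspace μ) (hy : J' y = c • y) : B x y = 0 := by
  rw [Module.End.mem_eigenspace_iff] at hx
  have e := hadj x y
  rw [hx, hy, map_smul, LinearMap.smul_apply, map_smul, smul_eq_mul, smul_eq_mul] at e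
  have e' : (μ - c) * B x y = 0 := by rw [sub_mul, e, sub_self]
  rcases mul_eq_zero.1 e' with h | h
  · exact absurd (sub_eq_zero.1 h) hμc
  · exact h

variable [FiniteDimensional ℂ V]

/-- **An operator in the double commutant of a diagonalisable operator is a scalar on each of its
eigenspaces**: if `V = ⨁_μ V_μ(J)` and `T` commutes with every `S` commuting with `J`, then for every
`ν` there is `c` with `T = c` on `V_ν(J)` (test `T` against the elementary operators of `End(V_ν)`,
which commute with `J`). For `J = φ^*` generating `C(A) ⊗ ℂ`' s commutant this says: the centre of
`C(A) ⊗ ℂ = ∏ End(V_ν)` is `∏ ℂ`. [cite: Milne1999LefschetzClasses, §2 p. 646 (`C(A) = End_E(V(A))`,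
centre `K`)] -/
theorem exists_forall_mem_eigenspace_apply_eq_smul (J T : Module.End ℂ V) (hJ : ⨆ μ, J.eigenspace μ = ⊤)
    (hT : ∀ S : Module.End ℂ V, S * J = J * S → S * T = T * S) (ν : ℂ) :
    ∃ c : ℂ, ∀ x ∈ J.eigenspace ν, T x = c • x := by
  classical
  by_cases hν : J.eigenspace ν = ⊥
  · refine ⟨0, fun x hx => ?_⟩
    rw [hν, Submodule.mem_bot] at hx
    rw [hx, map_zero, smul_zero]
  -- an eigenbasis of `V`
  obtain ⟨M, ⟨e⟩⟩ : ∃ M : ℕ, Nonempty (J.Eigenvalues ≃ Fin M) := ⟨_, ⟨Fintype.equivFin _⟩⟩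
  set μ₀ : Fin M → ℂ := fun k => ((e.symm k : J.Eigenvalues) : ℂ) with hμ₀_def
  have hμ₀inj : Function.Injective μ₀ := fun k k' h => e.symm.injective (Subtype.ext h)
  set E : Fin M → Submodule ℂ V := fun k => J.eigenspace (μ₀ k) with hE_def
  have hind : iSupIndep E := (Module.End.eigenspaces_iSupIndep J).comp hμ₀inj
  have hEof : ∀ {μ} (hμ : J.HasEigenvalue μ), J.eigenspace μ = E (e ⟨μ, hμ⟩) := fun {μ} hμ => by
    simp only [hE_def, hμ₀_def, Equiv.symm_apply_apply]
    rfl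
  have htop : iSup E = ⊤ := by
    refine eq_top_iff.2 ?_
    rw [← hJ]
    refine iSup_le fun μ => ?_
    by_cases hμ : J.HasEigenvalue μ
    · rw [hEof hμ]
      exact le_iSup E _
    · rw [Module.End.hasEigenvalue_iff, not_ne_iff] at hμ
      rw [hμ]
      exact bot_le
  have hint : DirectSum.IsInternal E := DirectSum.isInternal_submodule_of_iSupIndep_of_iSup_eq_top hind htop
  set b := hint.collectedBasis fun k => Module.finBasis ℂ (E k) with hb_def
  have hbmem : ∀ a, b a ∈ E a.1 := fun a => hint.collectedBasis_mem _ a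
  have hJb : ∀ a, J (b a) = μ₀ a.1 • b a := fun a => Module.End.mem_eigenspace_iff.1 (hbmem a)
  -- the block of `ν`
  have hνev : J.HasEigenvalue ν := Module.End.hasEigenvalue_iff.2 hν
  set k₀ : Fin M := e ⟨ν, hνev⟩ with hk₀_def
  have hEk₀ : J.eigenspace ν = E k₀ := hEof hνev
  -- elementary operators `b a₀ ↦ b a₁` inside the block commute with `J`
  have helem : ∀ a₀ a₁ : Σ k : Fin M, Fin (Module.finrank ℂ (E k)), a₀.1 = a₁.1 →
      T (b a₁) = (b.repr (T (b a₀)) a₀) • b a₁ := by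
    intro a₀ a₁ h01
    set S : Module.End ℂ V := b.constr ℂ fun a => if a = a₀ then b a₁ else 0 with hS_def
    have hSb : ∀ a, S (b a) = if a = a₀ then b a₁ else 0 := fun a => by
      rw [hS_def, Module.Basis.constr_basis]
    have hSv : ∀ v, S v = b.repr v a₀ • b a₁ := fun v => by
      rw [hS_def, Module.Basis.constr_apply_fintype]
      simp only [Module.Basis.equivFun_apply, smul_ite, smul_zero, Finset.sum_ite_eq', Finset.mem_univ,
        if_true]
    have hSJ : S * J = J * S := by
      refine b.ext fun a => ?_
      rw [Module.End.mul_apply, Module.End.mul_apply, hJb, map_smul, hSb]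
      by_cases ha : a = a₀
      · rw [if_pos ha, hJb, ha, h01]
      · rw [if_neg ha, smul_zero, map_zero]
    have e1 := congrArg (fun f : Module.End ℂ V => f (b a₀)) (hT S hSJ)
    simp only [Module.End.mul_apply] at e1
    rw [hSb, if_pos rfl] at e1
    rw [← e1, hSv]
  -- the scalar: the diagonal coefficient at the first basis vector of the block
  have hd₀ : 0 < Module.finrank ℂ (E k₀) := by
    refine Nat.pos_of_ne_zero fun h0 => hν ?_
    rw [hEk₀]
    exact Submodule.finrank_eq_zero.1 h0
  set a₀ : Σ k : Fin M, Fin (Module.finrank ℂ (E k)) := ⟨k₀, ⟨0, hd₀⟩⟩ with ha₀_def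
  refine ⟨b.repr (T (b a₀)) a₀, fun x hx => ?_⟩
  rw [hEk₀] at hx
  have hzero : ∀ a : Σ k : Fin M, Fin (Module.finrank ℂ (E k)), a.1 ≠ k₀ → b.repr x a = 0 := by
    rintro ⟨k, i⟩ hk
    exact hint.collectedBasis_repr_of_mem_ne _ (Ne.symm hk) hx
  conv_lhs => rw [← b.sum_repr x]
  conv_rhs => rw [← b.sum_repr x]
  rw [map_sum, Finset.smul_sum]
  refine Finset.sum_congr rfl fun a _ => ?_
  by_cases ha : a.1 = k₀
  · rw [map_smul, helem a₀ a (by rw [ha₀_def]; exact ha.symm), smul_comm]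
  · rw [hzero a ha, zero_smul, map_zero, smul_zero]

omit [FiniteDimensional ℂ V] in
/-- Non-degeneracy, left form. [folklore] -/
private theorem eq_zero_of_forall_apply_eq_zero' (B : LinearMap.BilinForm ℂ V) (hBalt : B.IsAlt)
    (hBnd : B.Nondegenerate) (x : V) (hx : ∀ y, B x y = 0) : x = 0 :=
  (hBalt.isRefl.nondegenerate_iff_separatingLeft.1 hBnd) x hx

omit [FiniteDimensional ℂ V] in
/-- A non-zero vector pairs non-trivially with some eigenvector (decompose along `⨆ V_μ = V`). [folklore] -/
private theorem exists_apply_ne_zero' (B : LinearMap.BilinForm ℂ V) (hBalt : B.IsAlt) (hBnd : B.Nondegenerate)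
    (J : Module.End ℂ V) (hJ : ⨆ μ, J.eigenspace μ = ⊤) {x : V} (hx : x ≠ 0) :
    ∃ (μ : ℂ) (y : V), y ∈ J.eigenspace μ ∧ B x y ≠ 0 := by
  by_contra hcon
  push Not at hcon
  refine hx (eq_zero_of_forall_apply_eq_zero' B hBalt hBnd x fun y => ?_)
  have hy : y ∈ ⨆ μ, J.eigenspace μ := by rw [hJ]; exact Submodule.mem_top
  induction hy using Submodule.iSup_induction' with
  | mem μ z hz => exact hcon μ z hz
  | zero => rw [map_zero]
  | add z w _ _ hz hw => rw [map_add, hz, hw, add_zero]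

omit [FiniteDimensional ℂ V] in
/-- **The pairing of eigenvalues is an involution**: if `V_μ ⊥ V_ν` unless `μ = c(ν)`, then for every
eigenvalue `ν` of `J`, `c(ν)` is an eigenvalue and `c(c(ν)) = ν` (`B` is non-degenerate and
alternating). For `J = φ^*`, `c = ` complex conjugation on the embeddings of the CM field `ℚ(φ)`
(type IV), or the identity (type I). [cite: Milne1999LefschetzClasses, §2 pp. 647–650] -/
theorem eigenspace_ne_bot_and_apply_apply_eq (B : LinearMap.BilinForm ℂ V) (hBalt : B.IsAlt) (hBnd : B.Nondegenerate)
    (J : Module.End ℂ V) (hJ : ⨆ μ, J.eigenspace μ = ⊤) (c : ℂ → ℂ)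
    (horth : ∀ (μ ν : ℂ) (x y : V), x ∈ J.eigenspace μ → y ∈ J.eigenspace ν → μ ≠ c ν → B x y = 0)
    {ν : ℂ} (hν : J.eigenspace ν ≠ ⊥) :
    J.eigenspace (c ν) ≠ ⊥ ∧ c (c ν) = ν := by
  obtain ⟨x, hxν, hx0⟩ := (Submodule.ne_bot_iff _).1 hν
  obtain ⟨μ, y, hy, hxy⟩ := exists_apply_ne_zero' B hBalt hBnd J hJ hx0
  have h1 : ν = c μ := by
    by_contra h
    exact hxy (horth ν μ x y hxν hy h)
  have hyx : B y x ≠ 0 := by rw [← hBalt.neg_eq, neg_ne_zero]; exact hxy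
  have h2 : μ = c ν := by
    by_contra h
    exact hyx (horth μ ν y x hy hxν h)
  have hy0 : y ≠ 0 := by
    rintro rfl
    exact hxy (by rw [map_zero])
  refine ⟨?_, by rw [← h2, ← h1]⟩
  rw [← h2]
  exact (Submodule.ne_bot_iff _).2 ⟨y, hy, hy0⟩

/-- **A paired basis of `V_ν ⊕ V_{c(ν)}`** (one block of Milne's decomposition): vectors `u_i ∈ V_ν`,
`v_i ∈ V_{c(ν)}` (`i < n`) with `B(u_i, u_j) = B(v_i, v_j) = 0`, `B(u_i, v_j) = δ_{ij}`, spanning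
`V_ν + V_{c(ν)}`: for `c(ν) = ν` a symplectic basis of the non-degenerate alternating space `V_ν`
(type `Sp`: McDuff–Salamon Thm. 2.1.3), for `c(ν) ≠ ν` a basis of the isotropic space `V_ν` and its
dual basis in `V_{c(ν)} ≅ V_ν^∨` (type `GL`: "the standard representation and its contragredient",
Milne §2 p. 650). [cite: Milne1999LefschetzClasses, §2 pp. 648–650] [cite: McDuffSalamon2017, Thm. 2.1.3] -/
theorem exists_pairedFamilies (B : LinearMap.BilinForm ℂ V) (hBalt : B.IsAlt) (hBnd : B.Nondegenerate)
    (J : Module.End ℂ V) (hJ : ⨆ μ, J.eigenspace μ = ⊤) (c : ℂ → ℂ)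
    (horth : ∀ (μ ν : ℂ) (x y : V), x ∈ J.eigenspace μ → y ∈ J.eigenspace ν → μ ≠ c ν → B x y = 0)
    (hcc : ∀ μ, J.eigenspace μ ≠ ⊥ → c (c μ) = μ) {ν : ℂ} (hνc : c (c ν) = ν) :
    ∃ (n : ℕ) (u v : Fin n → V), (∀ i, u i ∈ J.eigenspace ν) ∧ (∀ i, v i ∈ J.eigenspace (c ν)) ∧
      (∀ i j, B (u i) (u j) = 0) ∧ (∀ i j, B (v i) (v j) = 0) ∧
      (∀ i j, B (u i) (v j) = if i = j then 1 else 0) ∧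
      J.eigenspace ν ≤ Submodule.span ℂ (Set.range (Sum.elim u v)) ∧
      J.eigenspace (c ν) ≤ Submodule.span ℂ (Set.range (Sum.elim u v)) := by
  classical
  have hsepL := eq_zero_of_forall_apply_eq_zero' B hBalt hBnd
  by_cases hfix : c ν = ν
  · -- symplectic block: `V_ν` is non-degenerate
    rw [hfix]
    set H := J.eigenspace ν with hH_def
    have hdisj : Disjoint H (B.orthogonal H) := by
      rw [Submodule.disjoint_def]
      intro x hx hx'
      rw [LinearMap.BilinForm.mem_orthogonal_iff] at hx'
      have hall : ∀ y, B y x = 0 := by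
        intro y
        have hy : y ∈ ⨆ μ, J.eigenspace μ := by rw [hJ]; exact Submodule.mem_top
        induction hy using Submodule.iSup_induction' with
        | mem μ z hz =>
          by_cases hμ : μ = ν
          · subst hμ; exact hx' z hz
          · exact horth μ ν z x hz hx (by rw [hfix]; exact hμ)
        | zero => rw [map_zero, LinearMap.zero_apply]
        | add z w _ _ hz hw => rw [map_add, LinearMap.add_apply, hz, hw, add_zero]
      exact hsepL x fun y => by rw [← hBalt.neg_eq, hall, neg_zero]
    have hres : (B.restrict H).IsAlt ∧ (B.restrict H).Nondegenerate :=
      ⟨fun x => hBalt (x : V), B.nondegenerate_restrict_of_disjoint_orthogonal hBalt.isRefl hdisj⟩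
    obtain ⟨n, bH, h11, h22, h12⟩ :=
      Literature.Geometry.Symplectic.exists_symplecticBasis (B.restrict H) hres.1 hres.2
    have hspan : H ≤ Submodule.span ℂ (Set.range (Sum.elim (fun i => (bH (Sum.inl i) : V))
        (fun i => (bH (Sum.inr i) : V)))) := by
      have hfun : Sum.elim (fun i => (bH (Sum.inl i) : V)) (fun i => (bH (Sum.inr i) : V)) =
          H.subtype ∘ bH := by
        funext s; rcases s with i | i <;> rfl
      rw [hfun, Set.range_comp, Submodule.span_image, bH.span_eq, Submodule.map_subtype_top]
    refine ⟨n, fun i => (bH (Sum.inl i) : V), fun i => (bH (Sum.inr i) : V), fun i => Submodule.coe_mem _,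
      fun i => Submodule.coe_mem _, fun i j => ?_, fun i j => ?_, fun i j => ?_, hspan, hspan⟩
    · have e1 := h11 i j
      rwa [LinearMap.BilinForm.restrict_apply] at e1
    · have e1 := h22 i j
      rwa [LinearMap.BilinForm.restrict_apply] at e1
    · have e1 := h12 i j
      rwa [LinearMap.BilinForm.restrict_apply] at e1
  · -- general-linear block: `V_ν`, `V_{c ν}` isotropic and perfectly paired
    set H := J.eigenspace ν with hH_def
    set H' := J.eigenspace (c ν) with hH'_def
    have hne : ν ≠ c ν := Ne.symm hfix
    have hne' : c ν ≠ c (c ν) := by rw [hνc]; exact hfix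
    have hiso : ∀ x x', x ∈ H → x' ∈ H → B x x' = 0 := fun x x' hx hx' => horth ν ν x x' hx hx' hne
    have hiso' : ∀ y y', y ∈ H' → y' ∈ H' → B y y' = 0 := fun y y' hy hy' => horth _ _ y y' hy hy' hne'
    -- the pairing maps
    set Φ : H' →ₗ[ℂ] Module.Dual ℂ H := (LinearMap.domRestrict' H) ∘ₗ (B.flip.domRestrict H') with hΦ_def
    have hΦ : ∀ (y : H') (x : H), Φ y x = B (x : V) (y : V) := fun y x => rfl
    set Ψ : H →ₗ[ℂ] Module.Dual ℂ H' := (LinearMap.domRestrict' H') ∘ₗ (B.domRestrict H) with hΨ_def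
    have hΨ : ∀ (x : H) (y : H'), Ψ x y = B (x : V) (y : V) := fun x y => rfl
    have hΦinj : Function.Injective Φ := by
      rw [injective_iff_map_eq_zero]
      intro y hy
      have hy' : ∀ x ∈ H, B x y = 0 := fun x hx => by
        have e1 := DFunLike.congr_fun hy ⟨x, hx⟩
        rwa [hΦ, LinearMap.zero_apply] at e1
      have hall : ∀ z, B z y = 0 := by
        intro z
        have hz : z ∈ ⨆ μ, J.eigenspace μ := by rw [hJ]; exact Submodule.mem_top
        induction hz using Submodule.iSup_induction' with
        | mem μ z hz =>
          by_cases hμ : μ = ν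
          · subst hμ; exact hy' z hz
          · exact horth μ (c ν) z y hz y.2 (by rw [hνc]; exact hμ)
        | zero => rw [map_zero, LinearMap.zero_apply]
        | add z w _ _ hz hw => rw [map_add, LinearMap.add_apply, hz, hw, add_zero]
      exact Subtype.ext (hsepL y fun z => by rw [← hBalt.neg_eq, hall, neg_zero])
    have hΨinj : Function.Injective Ψ := by
      rw [injective_iff_map_eq_zero]
      intro x hx
      have hx' : ∀ y ∈ H', B x y = 0 := fun y hy => by
        have e1 := DFunLike.congr_fun hx ⟨y, hy⟩
        rwa [hΨ, LinearMap.zero_apply] at e1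
      refine Subtype.ext (hsepL x fun z => ?_)
      have hz : z ∈ ⨆ μ, J.eigenspace μ := by rw [hJ]; exact Submodule.mem_top
      induction hz using Submodule.iSup_induction' with
      | mem μ z hz =>
        by_cases hz0 : z = 0
        · rw [hz0, map_zero]
        by_cases hμ : μ = c ν
        · subst hμ; exact hx' z hz
        · refine horth ν μ x z x.2 hz fun h => hμ ?_
          have hμμ := hcc μ ((Submodule.ne_bot_iff _).2 ⟨z, hz, hz0⟩)
          rw [h, hμμ]
      | zero => rw [map_zero]
      | add z w _ _ hz hw => rw [map_add, hz, hw, add_zero]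
    have hle1 : Module.finrank ℂ H' ≤ Module.finrank ℂ H := by
      have e1 := LinearMap.finrank_le_finrank_of_injective hΦinj
      rwa [Subspace.dual_finrank_eq] at e1
    have hle2 : Module.finrank ℂ H ≤ Module.finrank ℂ H' := by
      have e1 := LinearMap.finrank_le_finrank_of_injective hΨinj
      rwa [Subspace.dual_finrank_eq] at e1
    have hdim : Module.finrank ℂ H' = Module.finrank ℂ (Module.Dual ℂ H) := by
      rw [Subspace.dual_finrank_eq]; exact le_antisymm hle1 hle2
    set Φe : H' ≃ₗ[ℂ] Module.Dual ℂ H := Φ.linearEquivOfInjective hΦinj hdim with hΦe_def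
    have hΦe : ∀ y, Φe y = Φ y := fun y => LinearMap.linearEquivOfInjective_apply hΦinj hdim y
    -- the bases
    set n := Module.finrank ℂ H with hn_def
    set bH := Module.finBasis ℂ H with hbH_def
    set bH' : Module.Basis (Fin n) ℂ H' := bH.dualBasis.map Φe.symm with hbH'_def
    have hpair : ∀ i j, B (bH i : V) (bH' j : V) = if i = j then 1 else 0 := by
      intro i j
      rw [← hΦ, ← hΦe, hbH'_def, Module.Basis.map_apply, LinearEquiv.apply_symm_apply,
        Module.Basis.dualBasis_apply_self]
    have hspan1 : H ≤ Submodule.span ℂ (Set.range fun i => (bH i : V)) := by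
      have hfun : (fun i => (bH i : V)) = H.subtype ∘ bH := rfl
      rw [hfun, Set.range_comp, Submodule.span_image, bH.span_eq, Submodule.map_subtype_top]
    have hspan2 : H' ≤ Submodule.span ℂ (Set.range fun i => (bH' i : V)) := by
      have hfun : (fun i => (bH' i : V)) = H'.subtype ∘ bH' := rfl
      rw [hfun, Set.range_comp, Submodule.span_image, bH'.span_eq, Submodule.map_subtype_top]
    refine ⟨n, fun i => (bH i : V), fun i => (bH' i : V), fun i => Submodule.coe_mem _,
      fun i => Submodule.coe_mem _, fun i j => hiso _ _ (Submodule.coe_mem _) (Submodule.coe_mem _),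
      fun i j => hiso' _ _ (Submodule.coe_mem _) (Submodule.coe_mem _), hpair,
      hspan1.trans (Submodule.span_mono ?_), hspan2.trans (Submodule.span_mono ?_)⟩
    · rintro _ ⟨i, rfl⟩; exact ⟨Sum.inl i, rfl⟩
    · rintro _ ⟨i, rfl⟩; exact ⟨Sum.inr i, rfl⟩

/-- **A block basis adapted to an adjoint pair** (Milne's decomposition `V = ⊕ V_σ`,
`S(A)(ℂ) = ∏ Sp × ∏ GL`, for one generator). Let `B` be non-degenerate alternating, `J` diagonalisable
with `V_μ ⊥ V_ν` unless `μ = c(ν)`. Then `V` has a basis `(e^k_i, f^k_i)_{k < m, i < n_k}` with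
`J e^k_i = ν_k e^k_i`, `J f^k_i = c(ν_k) f^k_i`, the blocks `{ν_k, c(ν_k)}` pairwise disjoint
(`c(c(ν_k)) = ν_k`), symplectic relations inside each block (`B(e^k_i, f^k_j) = δ_{ij}`,
`B(e, e) = B(f, f) = 0`) and `B = 0` across blocks: the blocks with `c(ν_k) = ν_k` are symplectic
(`Sp(V_{ν_k})`), the others general linear (`V_{ν_k} ⊕ V_{c(ν_k)} = W ⊕ W^∨`, `GL(W)`).
[cite: Milne1999LefschetzClasses, §2 pp. 646–650 and p. 656] [cite: McDuffSalamon2017, Thm. 2.1.3] -/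
theorem exists_blockBasis_of_orthogonality (B : LinearMap.BilinForm ℂ V) (hBalt : B.IsAlt) (hBnd : B.Nondegenerate)
    (J : Module.End ℂ V) (hJ : ⨆ μ, J.eigenspace μ = ⊤) (c : ℂ → ℂ)
    (horth : ∀ (μ ν : ℂ) (x y : V), x ∈ J.eigenspace μ → y ∈ J.eigenspace ν → μ ≠ c ν → B x y = 0) :
    ∃ (m : ℕ) (n : Fin m → ℕ) (ν : Fin m → ℂ) (b : Module.Basis (Σ k : Fin m, Fin (n k) ⊕ Fin (n k)) ℂ V),
      (∀ k k', (ν k' = ν k ∨ ν k' = c (ν k)) → k' = k) ∧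
      (∀ k, c (c (ν k)) = ν k) ∧
      (∀ k (i : Fin (n k)), J (b ⟨k, Sum.inl i⟩) = ν k • b ⟨k, Sum.inl i⟩) ∧
      (∀ k (i : Fin (n k)), J (b ⟨k, Sum.inr i⟩) = c (ν k) • b ⟨k, Sum.inr i⟩) ∧
      (∀ a a', a.1 ≠ a'.1 → B (b a) (b a') = 0) ∧
      (∀ k (i j : Fin (n k)), B (b ⟨k, Sum.inl i⟩) (b ⟨k, Sum.inl j⟩) = 0) ∧
      (∀ k (i j : Fin (n k)), B (b ⟨k, Sum.inr i⟩) (b ⟨k, Sum.inr j⟩) = 0) ∧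
      (∀ k (i j : Fin (n k)), B (b ⟨k, Sum.inl i⟩) (b ⟨k, Sum.inr j⟩) = if i = j then 1 else 0) := by
  classical
  have hfix : ∀ μ, J.eigenspace μ ≠ ⊥ → J.eigenspace (c μ) ≠ ⊥ ∧ c (c μ) = μ := fun μ hμ =>
    eigenspace_ne_bot_and_apply_apply_eq B hBalt hBnd J hJ c horth hμ
  -- the eigenvalues, the involution `τ`, and representatives of its orbits
  obtain ⟨M, ⟨e⟩⟩ : ∃ M : ℕ, Nonempty (J.Eigenvalues ≃ Fin M) := ⟨_, ⟨Fintype.equivFin _⟩⟩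
  have hval : ∀ i : J.Eigenvalues, J.eigenspace (i : ℂ) ≠ ⊥ := fun i => Module.End.hasEigenvalue_iff.1 i.2
  let τ : J.Eigenvalues → J.Eigenvalues := fun i =>
    ⟨c i, Module.End.hasEigenvalue_iff.2 (hfix i (hval i)).1⟩
  have hτc : ∀ i, ((τ i : J.Eigenvalues) : ℂ) = c i := fun _ => rfl
  have hττ : ∀ i, τ (τ i) = i := fun i => Subtype.ext (hfix i (hval i)).2
  set R : Finset J.Eigenvalues := Finset.univ.filter fun i => e i ≤ e (τ i) with hR_def
  obtain ⟨m, ⟨r⟩⟩ : ∃ m : ℕ, Nonempty (Fin m ≃ R) := ⟨_, ⟨(Fintype.equivFin R).symm⟩⟩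
  set ν : Fin m → ℂ := fun k => ((r k : R) : J.Eigenvalues) with hν_def
  have hνR : ∀ k, e ((r k : R) : J.Eigenvalues) ≤ e (τ ((r k : R) : J.Eigenvalues)) := fun k =>
    (Finset.mem_filter.1 (r k).2).2
  have hcν : ∀ k, c (c (ν k)) = ν k := fun k => (hfix _ (hval _)).2
  have hsep : ∀ k k', (ν k' = ν k ∨ ν k' = c (ν k)) → k' = k := by
    rintro k k' (h | h)
    · exact r.injective (Subtype.ext (Subtype.ext h))
    · have h1 : ((r k' : R) : J.Eigenvalues) = τ ((r k : R) : J.Eigenvalues) := Subtype.ext h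
      have h2 : τ ((r k' : R) : J.Eigenvalues) = ((r k : R) : J.Eigenvalues) := by rw [h1, hττ]
      have le1 := hνR k
      have le2 := hνR k'
      rw [← h1] at le1
      rw [h2] at le2
      exact r.injective (Subtype.ext (e.injective (le_antisymm le2 le1)))
  have hcover : ∀ μ, J.eigenspace μ ≠ ⊥ → ∃ k, μ = ν k ∨ μ = c (ν k) := by
    intro μ hμ
    set i : J.Eigenvalues := ⟨μ, Module.End.hasEigenvalue_iff.2 hμ⟩ with hi_def
    by_cases hi : e i ≤ e (τ i)
    · refine ⟨r.symm ⟨i, Finset.mem_filter.2 ⟨Finset.mem_univ _, hi⟩⟩, Or.inl ?_⟩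
      rw [hν_def]
      simp only [Equiv.apply_symm_apply]
      rfl
    · have hi' : e (τ i) ≤ e (τ (τ i)) := by rw [hττ]; exact (lt_of_not_ge hi).le
      refine ⟨r.symm ⟨τ i, Finset.mem_filter.2 ⟨Finset.mem_univ _, hi'⟩⟩, Or.inr ?_⟩
      rw [hν_def]
      simp only [Equiv.apply_symm_apply]
      exact (hfix μ hμ).2.symm
  -- the paired families, block by block
  have hblk := fun k => exists_pairedFamilies B hBalt hBnd J hJ c horth (fun μ hμ => (hfix μ hμ).2) (hcν k)
  choose n u v hu hv huu hvv huv hsp1 hsp2 using hblk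
  -- the family and its partner family
  let w : (Σ k : Fin m, Fin (n k) ⊕ Fin (n k)) → V := fun a => Sum.elim (u a.1) (v a.1) a.2
  have hcross : ∀ a a' : Σ k : Fin m, Fin (n k) ⊕ Fin (n k), a.1 ≠ a'.1 → B (w a) (w a') = 0 := by
    rintro ⟨k, i | i⟩ ⟨k', j | j⟩ hkk'
    all_goals simp only [w, Sum.elim_inl, Sum.elim_inr]
    all_goals simp only at hkk'
    · exact horth _ _ _ _ (hu k i) (hu k' j) fun h => hkk' (hsep k' k (Or.inr h))
    · refine horth _ _ _ _ (hu k i) (hv k' j) fun h => hkk' (hsep k' k (Or.inl ?_))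
      rw [h, hcν]
    · refine horth _ _ _ _ (hv k i) (hu k' j) fun h => hkk' (hsep k' k (Or.inl ?_))
      rw [← hcν k, h, hcν]
    · refine horth _ _ _ _ (hv k i) (hv k' j) fun h => hkk' ?_
      rw [hcν] at h
      exact (hsep k k' (Or.inr h.symm)).symm
  let w' : (Σ k : Fin m, Fin (n k) ⊕ Fin (n k)) → V := fun a => Sum.elim (v a.1) (fun i => -u a.1 i) a.2
  have hpair : ∀ a a', B (w a) (w' a') = if a = a' then 1 else 0 := by
    rintro ⟨k, i | i⟩ ⟨k', j | j⟩
    all_goals simp only [w, w', Sum.elim_inl, Sum.elim_inr, Sigma.mk.inj_iff, map_neg]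
    · by_cases hk : k = k'
      · subst hk
        simp only [heq_eq_eq, Sum.inl.injEq, true_and, huv]
      · rw [if_neg (fun h => hk h.1)]
        exact hcross ⟨k, Sum.inl i⟩ ⟨k', Sum.inr j⟩ hk
    · rw [if_neg (fun h => ?_), neg_eq_zero]
      · by_cases hk : k = k'
        · subst hk; exact huu k i j
        · exact hcross ⟨k, Sum.inl i⟩ ⟨k', Sum.inl j⟩ hk
      · obtain ⟨rfl, h2⟩ := h
        simp at h2
    · rw [if_neg (fun h => ?_)]
      · by_cases hk : k = k'
        · subst hk; exact hvv k i j
        · exact hcross ⟨k, Sum.inr i⟩ ⟨k', Sum.inr j⟩ hk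
      · obtain ⟨rfl, h2⟩ := h
        simp at h2
    · by_cases hk : k = k'
      · subst hk
        rw [← hBalt.neg_eq, neg_neg, huv]
        simp only [heq_eq_eq, Sum.inr.injEq, true_and]
        by_cases hij : i = j
        · rw [if_pos hij, if_pos hij.symm]
        · rw [if_neg hij, if_neg (Ne.symm hij)]
      · rw [if_neg (fun h => hk h.1), neg_eq_zero]
        exact hcross ⟨k, Sum.inr i⟩ ⟨k', Sum.inl j⟩ hk
  have hli : LinearIndependent ℂ w := by
    rw [Fintype.linearIndependent_iff]
    intro g hg a'
    have e1 := congrArg (fun z => B z (w' a')) hg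
    simp only [LinearMap.BilinForm.sum_left, LinearMap.BilinForm.smul_left, hpair, mul_ite, mul_one, mul_zero,
      Finset.sum_ite_eq', Finset.mem_univ, if_true, map_zero, LinearMap.zero_apply] at e1
    exact e1
  have hsub : ∀ k, Set.range (Sum.elim (u k) (v k)) ⊆ Set.range w := by
    rintro k _ ⟨i | i, rfl⟩
    exacts [⟨⟨k, Sum.inl i⟩, rfl⟩, ⟨⟨k, Sum.inr i⟩, rfl⟩]
  have hsp : ⊤ ≤ Submodule.span ℂ (Set.range w) := by
    rw [← hJ]
    refine iSup_le fun μ => ?_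
    by_cases hμ : J.eigenspace μ = ⊥
    · rw [hμ]; exact bot_le
    obtain ⟨k, hk | hk⟩ := hcover μ hμ
    · rw [hk]; exact (hsp1 k).trans (Submodule.span_mono (hsub k))
    · rw [hk]; exact (hsp2 k).trans (Submodule.span_mono (hsub k))
  refine ⟨m, n, ν, Module.Basis.mk hli hsp, hsep, hcν, fun k i => ?_, fun k i => ?_, fun a a' haa' => ?_,
    fun k i j => ?_, fun k i j => ?_, fun k i j => ?_⟩
  · rw [Module.Basis.mk_apply]
    exact Module.End.mem_eigenspace_iff.1 (hu k i)
  · rw [Module.Basis.mk_apply]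
    exact Module.End.mem_eigenspace_iff.1 (hv k i)
  · rw [Module.Basis.mk_apply, Module.Basis.mk_apply]
    exact hcross a a' haa'
  · rw [Module.Basis.mk_apply, Module.Basis.mk_apply]
    exact huu k i j
  · rw [Module.Basis.mk_apply, Module.Basis.mk_apply]
    exact hvv k i j
  · rw [Module.Basis.mk_apply, Module.Basis.mk_apply]
    exact huv k i j

end AdjointPair

/-! ### §2 The torus, the block permutations and the block projectors commute with `φ^*` -/

section Commute₂

variable {V : Type*} [AddCommGroup V] [Module ℂ V] {ι : Type*} (b : Module.Basis ι ℂ V)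
  (J : Module.End ℂ V) (ev : ι → ℂ) (hJ : ∀ a, J (b a) = ev a • b a)
include hJ

/-- A diagonal automorphism of an eigenbasis of `J` commutes with `J`.
[cite: Milne1999LefschetzClasses, §2 p. 646 (`α = α₁ ⊕ ⋯ ⊕ α_t`)] -/
theorem mul_eq_mul_of_diag_of_eigenbasis (u : V ≃ₗ[ℂ] V) {d : ι → ℂ} (hd : ∀ a, u (b a) = d a • b a) :
    J * (u : Module.End ℂ V) = (u : Module.End ℂ V) * J := by
  refine b.ext fun a => ?_
  simp only [Module.End.mul_apply, LinearEquiv.coe_coe, hd, map_smul, hJ]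
  rw [smul_comm]

/-- A permutation of an eigenbasis of `J` preserving the eigenvalues commutes with `J`.
[cite: Milne1999LefschetzClasses, §2 p. 646 (`α = α₁ ⊕ ⋯ ⊕ α_t`)] -/
theorem mul_eq_mul_of_perm_of_eigenbasis (u : V ≃ₗ[ℂ] V) (π : Equiv.Perm ι) (hπ : ∀ a, ev (π a) = ev a)
    (hu : ∀ a, u (b a) = b (π a)) : J * (u : Module.End ℂ V) = (u : Module.End ℂ V) * J := by
  refine b.ext fun a => ?_
  simp only [Module.End.mul_apply, LinearEquiv.coe_coe, hu, hJ, map_smul, hπ]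

end Commute₂

section Projector₂

variable {A : AbelianVariety ℂ} {m : ℕ} {n : Fin m → ℕ}

/-- **The block projectors are polynomials in `φ^*`** (mixed blocks): for every block `k` there is a
polynomial `q_k` — the Lagrange interpolation polynomial of the indicator of `{ν_k, ν̄_k}` on the
spectrum (Milne's idempotent `e_σ` of `F ⊗ k`, p. 646) — with `q_k(φ^*)` the identity on block `k` and
zero on the other blocks (so `⋀²q_k(φ^*)` preserves `B¹ ⊗ ℂ`,
`exteriorPullback_aeval_pullbackOne_mem_hodgeClassSpan_one`).
[cite: Milne1999LefschetzClasses, §2 p. 646 (`1 = e₁ + ⋯ + e_t`, `V_i = e_i V`)] -/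
theorem exists_polynomial_blockProjector
    (b₁ : Module.Basis (Σ k : Fin m, Fin (n k) ⊕ Fin (n k)) ℂ (complexBetti A.X 1)) (φ : A ⟶ A)
    (ν : Fin m → ℂ) (c : ℂ → ℂ) (hsep : ∀ k k', (ν k' = ν k ∨ ν k' = c (ν k)) → k' = k)
    (hcν : ∀ k, c (c (ν k)) = ν k)
    (hJ1 : ∀ k (i : Fin (n k)), pullbackOne A φ (b₁ ⟨k, Sum.inl i⟩) = ν k • b₁ ⟨k, Sum.inl i⟩)
    (hJ2 : ∀ k (i : Fin (n k)), pullbackOne A φ (b₁ ⟨k, Sum.inr i⟩) = c (ν k) • b₁ ⟨k, Sum.inr i⟩)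
    (k : Fin m) :
    ∃ q : ℂ[X], ∀ a, aeval (pullbackOne A φ) q (b₁ a) = (if a.1 = k then (1 : ℂ) else 0) • b₁ a := by
  classical
  -- the eigenvalue of each basis vector, and the nodes
  let ev : (Σ k : Fin m, Fin (n k) ⊕ Fin (n k)) → ℂ := fun a => Sum.elim (fun _ => ν a.1) (fun _ => c (ν a.1)) a.2
  have hev : ∀ a, pullbackOne A φ (b₁ a) = ev a • b₁ a := by
    rintro ⟨k', i | i⟩
    exacts [hJ1 k' i, hJ2 k' i]
  have hevk : ∀ a, (ev a = ν k ∨ ev a = c (ν k)) ↔ a.1 = k := by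
    rintro ⟨k', i | i⟩ <;> simp only [ev, Sum.elim_inl, Sum.elim_inr]
    · exact ⟨fun h => hsep k k' h, fun h => Or.inl (by rw [h])⟩
    · refine ⟨fun h => ?_, fun h => Or.inr (by rw [h])⟩
      rcases h with h | h
      · refine hsep k k' (Or.inr ?_)
        rw [← hcν k', h]
      · refine hsep k k' (Or.inl ?_)
        rw [← hcν k', h, hcν]
  set s : Finset ℂ := Finset.univ.image ev with hs_def
  set rval : ℂ → ℂ := fun z => if z = ν k ∨ z = c (ν k) then 1 else 0 with hr_def
  refine ⟨Lagrange.interpolate s id rval, fun a => ?_⟩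
  have hvec : (pullbackOne A φ).HasEigenvector (ev a) (b₁ a) :=
    Module.End.hasEigenvector_iff.2 ⟨Module.End.mem_eigenspace_iff.2 (hev a), b₁.ne_zero a⟩
  rw [Module.End.aeval_apply_of_hasEigenvector hvec]
  congr 1
  have hnode : ev a ∈ s := Finset.mem_image_of_mem ev (Finset.mem_univ a)
  have e1 := Lagrange.eval_interpolate_at_node rval (Set.injOn_id (s : Set ℂ)) hnode
  rw [id] at e1
  rw [e1, hr_def]
  simp only [hevk]

end Projector₂

/-! ### §3 Words with prescribed letter counts -/

section Words₂

variable {m : ℕ}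

/-- **A word with prescribed letter counts**: for `c : Fin m → ℕ` with `Σ c_k = p` there is a word
`w : Fin p → Fin m` using each letter `k` exactly `c_k` times (`c_0` copies of `0`, then `c_1` copies
of `1`, …). [cite: Milne1999LefschetzClasses, §3 proof of Prop. 3.6 (the generators `φ ⊗ ⋯ ⊗ φ`)] -/
theorem exists_word_card_filter_eq (c : Fin m → ℕ) {p : ℕ} (hp : ∑ k, c k = p) :
    ∃ w : Fin p → Fin m, ∀ k, (Finset.univ.filter fun i => w i = k).card = c k := by
  classical
  subst hp
  refine ⟨fun i => (finSigmaFinEquiv.symm i).1, fun k => ?_⟩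
  have h1 : (Finset.univ.filter fun i : Fin (∑ k, c k) => (finSigmaFinEquiv.symm i).1 = k) =
      (Finset.univ.filter fun x : (Σ k : Fin m, Fin (c k)) => x.1 = k).map finSigmaFinEquiv.toEmbedding := by
    ext i
    simp only [Finset.mem_filter, Finset.mem_univ, true_and, Finset.mem_map_equiv]
  rw [h1, Finset.card_map]
  have h2 : (Finset.univ.filter fun x : (Σ k : Fin m, Fin (c k)) => x.1 = k) =
      ({k} : Finset (Fin m)).sigma fun k' => (Finset.univ : Finset (Fin (c k'))) := by
    ext ⟨k', i⟩
    simp only [Finset.mem_filter, Finset.mem_univ, true_and, Finset.mem_sigma, Finset.mem_singleton, and_true]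
  rw [h2, Finset.card_sigma, Finset.sum_singleton, Finset.card_univ, Fintype.card_fin]

end Words₂

/-! ### §4 Milne 1999, Thm. 3.2 / Prop. 3.6 (a), (c) / Cor. 4.5 for one generator with a Rosati partner -/

section Main

variable {A : AbelianVariety ℂ}

/-- **Milne 1999, Prop. 3.6 (a) and (c) in every block, glued as on p. 656: the `S(A)(ℂ)`-invariants of
`H^{2p}(A(ℂ); ℂ)` are Lefschetz classes, for one generator with a Rosati partner.** Let `φ ∈ End(A)`
with `φ^*` diagonalisable on `H¹(A(ℂ); ℂ)`, `C(A) ⊗ ℂ` the commutant of `φ^*`, `h` a polarization class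
(rational, with a Kähler multiple `s · h`, `s > 0`), and `J'` an operator commuting with `C(A) ⊗ ℂ`
(e.g. `J' = (φ†)^*`) with `Q_h(φ^*x, y) = Q_h(x, J'y)`. Then every invariant `x ∈ H^{2p}(A(ℂ); ℂ)` —
fixed by `⋀^{2p}u` for all `u ∈ S(A)(ℂ) = unitaryCentralizerGroup A h` — lies in
`Dᵖ(A) ⊗ ℂ = divisorClassesSpan A.X (dim A) p`. Proof: `J'` is a scalar `ν̄` on each `V_ν(φ^*)`
(§1), so `Q_h(V_μ, V_ν) = 0` unless `μ = ν̄`, and `H¹` has a block basis adapted to `(λ ∘ Q_h, φ^*)`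
(§1: blocks `Sp(V_ν)` for `ν̄ = ν`, `GL(V_ν)` on `V_ν ⊕ V_ν̄` for `ν̄ ≠ ν`); from there the argument of
`mem_divisorClassesSpan_of_forall_exteriorPullback_eq_of_selfAdjoint` applies word for word (torus and
block permutations in `S(A)(ℂ)`, block components `ω_k = ⋀²e_k h ∈ B¹ ⊗ ℂ`, `h = Σ ω_k`, symmetric
word products, `h^{dim A} ≠ 0`, engine). Degree `0` and `dim A = 0` apart.
[cite: Milne1999LefschetzClasses, §2 pp. 646–650 (types I, IV), Thm. 3.2, Props. 3.3–3.4, 3.6 (a), (c), p. 656]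
[cite: FultonHarris1991, §15.1, §16.1] [cite: VoisinHodgeI2002, §3.1.3 Cor. 3.9 and §7.1.2] -/
theorem mem_divisorClassesSpan_of_forall_exteriorPullback_eq_of_adjoint (φ : A ⟶ A)
    (hC : centralizerAlgebra A = Subalgebra.centralizer ℂ {pullbackOne A φ})
    (hdiag : ⨆ μ : ℂ, Module.End.eigenspace (pullbackOne A φ) μ = ⊤)
    {h : complexBetti A.X 2} (hQ : IsRationalClass h)
    (hK : ∃ s : ℝ, 0 < s ∧ IsKaehlerClass A.dim A.X ((s : ℂ) • h))
    (J' : Module.End ℂ (complexBetti A.X 1))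
    (hJ' : J' ∈ Subalgebra.centralizer ℂ (centralizerAlgebra A : Set (Module.End ℂ (complexBetti A.X 1))))
    (hJQ : ∀ x y : complexBetti A.X 1,
      polarizationPairingOne A.X h (A.dim - 1) (pullbackOne A φ x) y =
        polarizationPairingOne A.X h (A.dim - 1) x (J' y))
    (p : ℕ) (x : complexBetti A.X (2 * p))
    (hx : ∀ u ∈ unitaryCentralizerGroup A h,
      exteriorPullback (AbelianVariety.hasExteriorCohomologyH1_complexPoints A)
        (u : complexBetti A.X 1 →ₗ[ℂ] complexBetti A.X 1) (2 * p) x = x) :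
    x ∈ divisorClassesSpan A.X A.dim p := by
  classical
  haveI : Module.Finite ℂ (complexBetti A.X 1) := abelianVarietyCohomologyExteriorH1_holds.finite_one A
  have hX := AbelianVariety.hasExteriorCohomologyH1_complexPoints A
  -- degree `0`: everything is a multiple of the unit class
  rcases Nat.eq_zero_or_pos p with rfl | hp1
  · have htop : Submodule.span ℂ (Set.range (cupPowOne ℂ (ComplexPoints A.X) 0)) = ⊤ :=
      hX.span_range_cupPowOne 0
    have hrange : Set.range (cupPowOne ℂ (ComplexPoints A.X) 0) =
        {singularCohomology.one ℂ (ComplexPoints A.X)} := by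
      ext c
      simp only [Set.mem_range, cupPowOne_zero, Set.mem_singleton_iff]
      exact ⟨fun ⟨_, e⟩ => e.symm, fun e => ⟨fun i => Fin.elim0 i, e.symm⟩⟩
    have hx' : x ∈ Submodule.span ℂ (Set.range (cupPowOne ℂ (ComplexPoints A.X) 0)) := by
      rw [htop]; exact Submodule.mem_top
    rw [hrange] at hx'
    refine Submodule.span_mono (fun c hc => ?_) hx'
    rw [Set.mem_singleton_iff] at hc
    exact mem_divisorMonomials_zero.2 hc
  -- dimension `0`: no classes in positive degree
  rcases Nat.eq_zero_or_pos A.dim with hA | hA0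
  · haveI : Subsingleton (complexBetti A.X (2 * p)) :=
      hX.subsingleton_of_lt (by rw [AbelianVariety.finrank_complexBetti_one]; omega)
    rw [Subsingleton.elim x 0]
    exact Submodule.zero_mem _
  obtain ⟨s, hs, hKs⟩ := hK
  have hnd := eq_zero_of_forall_polarizationPairingOne_eq_zero_of_isKaehlerClass_smul' hs.ne' hKs
  have hh : h ∈ hodgeClassSpan A.dim A.X 1 := mem_hodgeClassSpan_one_of_isKaehlerClass_smul hQ hs.ne' hKs
  have hh11 : IsOfHodgeType A.dim A.X 2 1 1 h := by
    have e := (hKs.isOfHodgeType_one_one).smul ((s : ℂ)⁻¹)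
    rwa [smul_smul, inv_mul_cancel₀ (Complex.ofReal_ne_zero.2 hs.ne'), one_smul] at e
  have hdiv : h ∈ divisorClassesSpan A.X A.dim 1 := mem_divisorClassesSpan_one hQ hh11
  -- the scalar form `B = λ ∘ Q_h`; `(J, J') = (φ^*, J')` is an adjoint pair for `B`
  obtain ⟨B, hBalt, hBnd, lam, hlam, hBapp⟩ := exists_bilinForm_isAlt_nondegenerate (A := A) hnd
  set J : Module.End ℂ (complexBetti A.X 1) := pullbackOne A φ with hJ_def
  have hJB : ∀ x y, B (J x) y = B x (J' y) := fun x y => by rw [hBapp, hBapp, hJ_def, hJQ]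
  -- `J'` lies in the double commutant of `J`, hence is a scalar `c ν` on each eigenspace `V_ν(J)`
  have hJ'' : ∀ S : Module.End ℂ (complexBetti A.X 1), S * J = J * S → S * J' = J' * S := by
    intro S hS
    have hSC : S ∈ centralizerAlgebra A := by
      rw [hC, Subalgebra.mem_centralizer_iff]
      intro g hg
      rw [Set.mem_singleton_iff] at hg
      rw [hg, hJ_def]
      exact hS.symm
    exact (Subalgebra.mem_centralizer_iff ℂ |>.1 hJ') S hSC
  have hsc := fun μ => exists_forall_mem_eigenspace_apply_eq_smul J J' hdiag hJ'' μ
  choose c hc using hsc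
  have horth : ∀ (μ ν : ℂ) (x y : complexBetti A.X 1), x ∈ J.eigenspace μ → y ∈ J.eigenspace ν →
      μ ≠ c ν → B x y = 0 := fun μ ν x y hx hy hμν =>
    apply_eq_zero_of_mem_eigenspace_of_apply_eq_smul B J J' hJB hμν hx (hc ν y hy)
  -- the block basis adapted to the adjoint pair
  obtain ⟨m, n, ν, b₁, hsep, hcν, hJ1, hJ2, hcross, h11, h22, h12⟩ :=
    exists_blockBasis_of_orthogonality B hBalt hBnd J hdiag c horth
  have h21 : ∀ k (i j : Fin (n k)), B (b₁ ⟨k, Sum.inr i⟩) (b₁ ⟨k, Sum.inl j⟩) = if i = j then -1 else 0 := by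
    intro k i j
    rw [← hBalt.neg_eq, h12]
    by_cases hij : i = j
    · subst hij; simp
    · rw [if_neg (Ne.symm hij), if_neg hij, neg_zero]
  -- the eigenvalue of each basis vector
  let ev : (Σ k : Fin m, Fin (n k) ⊕ Fin (n k)) → ℂ := fun a => Sum.elim (fun _ => ν a.1) (fun _ => c (ν a.1)) a.2
  have hJb : ∀ a, J (b₁ a) = ev a • b₁ a := by
    rintro ⟨k, i | i⟩
    exacts [hJ1 k i, hJ2 k i]
  have hevπ : ∀ (σ : ∀ k : Fin m, Equiv.Perm (Fin (n k))) (a : Σ k : Fin m, Fin (n k) ⊕ Fin (n k)),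
      ev ((Equiv.sigmaCongrRight fun k => (σ k).sumCongr (σ k)) a) = ev a := by
    rintro σ ⟨k, i | i⟩ <;> rfl
  -- membership in `S(A)(ℂ)`: commute with `J` (hence with `End(A)`, by `hC`) and preserve `B`
  have hmem : ∀ u : complexBetti A.X 1 ≃ₗ[ℂ] complexBetti A.X 1,
      J * (u : Module.End ℂ (complexBetti A.X 1)) = (u : Module.End ℂ (complexBetti A.X 1)) * J →
      (∀ a c, B (u a) (u c) = B a c) → u ∈ unitaryCentralizerGroup A h := by
    intro u hcomm hu
    refine ⟨mem_centralizerGroup_iff_coe_mem.2 ?_, fun a c => hlam (by rw [← hBapp, ← hBapp, hu a c])⟩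
    rw [hC, Subalgebra.mem_centralizer_iff]
    intro g hg
    rw [Set.mem_singleton_iff] at hg
    rw [hg]
    exact hcomm
  -- reindexing of the basis and the cup-monomial bases of all degrees
  obtain ⟨N, ⟨E⟩⟩ : ∃ N : ℕ, Nonempty ((Σ k : Fin m, Fin (n k) ⊕ Fin (n k)) ≃ Fin N) :=
    ⟨_, ⟨Fintype.equivFin _⟩⟩
  have hbb' := fun d => exists_monomialBasis (b₁.reindex E) d
  choose bb hbb using hbb'
  -- the torus and the block permutations lie in `S(A)(ℂ)`
  have htorus : ∀ (k : Fin m) (i : Fin (n k)), ∃ u ∈ unitaryCentralizerGroup A h,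
      ∃ dg : (Σ k : Fin m, Fin (n k) ⊕ Fin (n k)) → ℂ, (∀ a, u (b₁ a) = dg a • b₁ a) ∧
        ∀ s : Finset (Σ k : Fin m, Fin (n k) ⊕ Fin (n k)), ∏ a ∈ s, dg a = 1 →
          ((⟨k, Sum.inl i⟩ : Σ k : Fin m, Fin (n k) ⊕ Fin (n k)) ∈ s ↔ ⟨k, Sum.inr i⟩ ∈ s) := by
    intro k i
    obtain ⟨u, huB, dg, hdg, hiff⟩ := exists_blockTorusElement B b₁ h11 h22 h12 h21 hcross k i
    exact ⟨u, hmem u (mul_eq_mul_of_diag_of_eigenbasis b₁ J ev hJb u hdg) huB, dg, hdg, hiff⟩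
  have hperm : ∀ σ : ∀ k : Fin m, Equiv.Perm (Fin (n k)), ∃ u ∈ unitaryCentralizerGroup A h,
      ∀ a, u (b₁ a) = b₁ ((Equiv.sigmaCongrRight fun k => (σ k).sumCongr (σ k)) a) := by
    intro σ
    obtain ⟨u, huB, hu⟩ := exists_blockPermElement B b₁ h11 h22 h12 h21 hcross σ
    exact ⟨u, hmem u (mul_eq_mul_of_perm_of_eigenbasis b₁ J ev hJb u _ (hevπ σ) hu) huB, hu⟩
  -- the block projectors `e_k` and the block components `ω_k = ⋀²e_k h ∈ B¹ ⊗ ℂ`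
  have hproj := fun k => exists_polynomial_blockProjector b₁ φ ν c hsep hcν hJ1 hJ2 k
  choose q hq using hproj
  set P : Fin m → (complexBetti A.X 1 →ₗ[ℂ] complexBetti A.X 1) := fun k => aeval J (q k) with hP_def
  have hP : ∀ k a, P k (b₁ a) = (if a.1 = k then (1 : ℂ) else 0) • b₁ a := fun k a => hq k a
  set ω : Fin m → complexBetti A.X 2 := fun k => exteriorPullback hX (P k) 2 h with hω_def
  have hωmem : ∀ k, ω k ∈ hodgeClassSpan A.dim A.X 1 := fun k =>
    exteriorPullback_aeval_pullbackOne_mem_hodgeClassSpan_one φ (q k) hh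
  have hωrepr : ∀ (k : Fin m) (t : Set.powersetCard (Fin N) 2),
      (bb 2).repr (ω k) t = (∏ j ∈ (t : Finset (Fin N)), (if (E.symm j).1 = k then (1 : ℂ) else 0)) * (bb 2).repr h t :=
    fun k t => repr_exteriorPullback_of_diag b₁ E (bb 2) (hbb 2) (P k) (hP k) h t
  have hωsupp : ∀ (k : Fin m) (t : Set.powersetCard (Fin N) 2),
      (bb 2).repr (ω k) t ≠ 0 → ∀ j ∈ (t : Finset (Fin N)), (E.symm j).1 = k := by
    intro k t ht j hj
    by_contra hjk
    apply ht
    rw [hωrepr, Finset.prod_eq_zero hj (if_neg hjk), zero_mul]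
  -- `h` is `S(A)(ℂ)`-invariant, hence supported on the pairs `{e^k_i, f^k_i}`; so `h = Σ_k ω_k`
  have hinvh : ∀ u ∈ unitaryCentralizerGroup A h,
      exteriorPullback hX (u : complexBetti A.X 1 →ₗ[ℂ] complexBetti A.X 1) 2 h = h := fun u hu =>
    exteriorPullback_eq_self_of_mem_divisorClassesSpan_of_nondegenerate hh hnd hu 1 hdiv
  have hsumω : ∑ k, ω k = h := by
    refine (bb 2).repr.injective (Finsupp.ext fun t => ?_)
    rw [map_sum, Finsupp.finsetSum_apply]
    simp_rw [hωrepr]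
    rw [← Finset.sum_mul]
    by_cases ht : (bb 2).repr h t = 0
    · rw [ht, mul_zero]
    · have hbal := balanced_of_repr_ne_zero b₁ E (bb 2) (hbb 2) (unitaryCentralizerGroup A h) htorus hinvh ht
      obtain ⟨k₀, hk₀⟩ := exists_forall_fst_eq_of_balanced_two E t hbal
      have hne : (t : Finset (Fin N)).Nonempty := by
        rw [← Finset.card_pos, Set.powersetCard.card_eq t]
        norm_num
      obtain ⟨j₀, hj₀⟩ := hne
      rw [Finset.sum_eq_single k₀, Finset.prod_eq_one (fun j hj => if_pos (hk₀ j hj)), one_mul]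
      · intro k _ hk
        exact Finset.prod_eq_zero hj₀ (if_neg fun e => hk (e.symm.trans (hk₀ j₀ hj₀)))
      · intro hk₀'
        exact absurd (Finset.mem_univ k₀) hk₀'
  -- the products `ω_w` along words (by recursion; no definition)
  let Y : ∀ q : ℕ, (Fin q → Fin m) → complexBetti A.X (2 * q) := fun q =>
    Nat.rec (motive := fun q => (Fin q → Fin m) → complexBetti A.X (2 * q))
      (fun _ => singularCohomology.one ℂ (ComplexPoints A.X))
      (fun q ih w => cupProduct (two_mul_add_two q) (ih (Fin.init w)) (ω (w (Fin.last q)))) q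
  have hY0 : ∀ w, Y 0 w = singularCohomology.one ℂ (ComplexPoints A.X) := fun _ => rfl
  have hYs : ∀ (q : ℕ) (w : Fin (q + 1) → Fin m),
      Y (q + 1) w = cupProduct (two_mul_add_two q) (Y q (Fin.init w)) (ω (w (Fin.last q))) := fun _ _ => rfl
  -- `Σ_k n_k = dim A` and `h^{dim A} ≠ 0`
  have hdimsum : ∑ k, n k = A.dim := sum_eq_dim_of_blockBasis b₁
  have hne : cupPowTwo (∑ k, ω k) (∑ k, n k) ≠ 0 := by
    rw [hsumω, hdimsum]
    intro h0
    have e := hKs.cupPowTwo_ne_zero (AbelianVariety.isSmoothProjective_holds (A := A)) hA0 le_rfl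
    rw [cupPowTwo_smul, h0, smul_zero] at e
    exact e rfl
  -- the engine
  refine mem_of_forall_exteriorPullback_eq_of_blockBasis b₁ E (bb (2 * p)) (hbb (2 * p))
    (unitaryCentralizerGroup A h) htorus hperm (divisorClassesSpan A.X A.dim p) (fun s₀ hs₀ => ?_) hx
  -- the block profile `(c_k)` of the balanced set `s₀`: `2 c_k` indices in block `k`, `Σ c_k = p`, `c_k ≤ n_k`
  obtain ⟨cnt, hc_def⟩ : ∃ cnt : Fin m → ℕ,
      ∀ k, cnt k = (Finset.univ.filter fun i : Fin (n k) => E ⟨k, Sum.inl i⟩ ∈ (s₀ : Finset (Fin N))).card :=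
    ⟨_, fun k => rfl⟩
  have hc2 : ∀ k, 2 * cnt k = ((s₀ : Finset (Fin N)).filter fun j => (E.symm j).1 = k).card := fun k => by
    rw [hc_def]
    exact two_mul_card_filter_eq_blockCount E k s₀ hs₀
  have hcle : ∀ k, cnt k ≤ n k := fun k => by
    rw [hc_def]
    refine (Finset.card_filter_le _ _).trans ?_
    rw [Finset.card_univ, Fintype.card_fin]
  have hcsum : ∑ k, cnt k = p := by
    have e := Finset.card_eq_sum_card_fiberwise (f := fun j => (E.symm j).1) (s := (s₀ : Finset (Fin N)))
      (t := Finset.univ) (fun j _ => Finset.mem_univ _)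
    rw [Set.powersetCard.card_eq s₀] at e
    have e2 : ∑ k, ((s₀ : Finset (Fin N)).filter fun j => (E.symm j).1 = k).card = 2 * ∑ k, cnt k := by
      rw [Finset.mul_sum]
      exact Finset.sum_congr rfl fun k _ => (hc2 k).symm
    omega
  -- a word with `c_k` letters `k`, and its product
  obtain ⟨w, hwcount⟩ := exists_word_card_filter_eq cnt hcsum
  have hymem : Y p w ∈ divisorClassesSpan A.X A.dim p := wordProd_mem_divisorClassesSpan ω Y hY0 hYs hωmem p w
  refine ⟨Y p w, hymem, fun u hu => ?_, ?_, fun t ht k => ?_⟩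
  · exact exteriorPullback_eq_self_of_mem_divisorClassesSpan_of_nondegenerate hh hnd hu p hymem
  · exact wordProd_ne_zero_of_le b₁ E bb hbb ω Y hY0 hYs hωsupp hne w (fun k => (hwcount k).le.trans (hcle k))
  · rw [card_filter_eq_of_repr_wordProd_ne_zero b₁ E bb hbb ω Y hYs hωsupp p w t ht k, hwcount, hc2]

/-- **The conclusion of the record `Milne1999_specialLefschetzGroup_invariants_le` (Milne 1999, Cor. 4.5
with Thm. 4.4 and Thm. 3.2 / Prop. 3.6 (a), (c), mixed blocks) PROVED for one generator with a Rosati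
partner**: for a complex abelian variety `A` with `φ ∈ End(A)`, `φ^*` diagonalisable on `H¹(A(ℂ); ℂ)`,
`C(A) ⊗ ℂ` the commutant of `φ^*`, and a polarization class `h` (rational, with a Kähler multiple) for
which the `Q_h`-adjoint of `φ^*` is an operator `J'` commuting with `C(A) ⊗ ℂ` (Milne §2: simple
abelian varieties of type I, `S(A)(ℂ) = ∏_σ Sp`, and of type IV with `d = 1`, `S(A)(ℂ) = ∏_σ GL`),
every class `x ∈ H^{2p}(A(ℂ); ℂ)` fixed by every element of `specialLefschetzGroup (dim A) A.X` lies in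
`Dᵖ_hom(A)_ℂ = divisorClassesSpan A.X (dim A) p` (`⋀•u ∈ specialLefschetzGroup` for `u ∈ S(A)(ℂ)`,
`exteriorPullbackEquiv_mem_specialLefschetzGroup`, Thm. 4.4; in dimension `0` there is nothing to prove).
[cite: Milne1999LefschetzClasses, §2 pp. 646–650, Cor. 4.5 and p. 659, Thm. 3.2, Prop. 3.6 (a), (c), p. 656]
[cite: VoisinHodgeI2002, §3.1.3 Cor. 3.9 and §7.1.2] -/
theorem specialLefschetzGroup_invariants_le_of_adjoint (φ : A ⟶ A)
    (hC : centralizerAlgebra A = Subalgebra.centralizer ℂ {pullbackOne A φ})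
    (hdiag : ⨆ μ : ℂ, Module.End.eigenspace (pullbackOne A φ) μ = ⊤)
    {h : complexBetti A.X 2} (hQ : IsRationalClass h)
    (hK : ∃ s : ℝ, 0 < s ∧ IsKaehlerClass A.dim A.X ((s : ℂ) • h))
    (J' : Module.End ℂ (complexBetti A.X 1))
    (hJ' : J' ∈ Subalgebra.centralizer ℂ (centralizerAlgebra A : Set (Module.End ℂ (complexBetti A.X 1))))
    (hJQ : ∀ x y : complexBetti A.X 1,
      polarizationPairingOne A.X h (A.dim - 1) (pullbackOne A φ x) y =
        polarizationPairingOne A.X h (A.dim - 1) x (J' y))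
    (p : ℕ) (x : complexBetti A.X (2 * p)) (hx : ∀ g ∈ specialLefschetzGroup A.dim A.X, g (2 * p) x = x) :
    x ∈ divisorClassesSpan A.X A.dim p := by
  classical
  haveI : Module.Finite ℂ (complexBetti A.X 1) := abelianVarietyCohomologyExteriorH1_holds.finite_one A
  have hX := AbelianVariety.hasExteriorCohomologyH1_complexPoints A
  -- dimension `0`: `H¹ = 0`, so `H^{2p} = 0` for `p ≥ 1` and `H⁰ = ℂ · 1`
  rcases Nat.eq_zero_or_pos A.dim with hA | hA0
  · rcases Nat.eq_zero_or_pos p with rfl | hp1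
    · have htop : Submodule.span ℂ (Set.range (cupPowOne ℂ (ComplexPoints A.X) 0)) = ⊤ :=
        hX.span_range_cupPowOne 0
      have hrange : Set.range (cupPowOne ℂ (ComplexPoints A.X) 0) =
          {singularCohomology.one ℂ (ComplexPoints A.X)} := by
        ext c
        simp only [Set.mem_range, cupPowOne_zero, Set.mem_singleton_iff]
        exact ⟨fun ⟨_, e⟩ => e.symm, fun e => ⟨fun i => Fin.elim0 i, e.symm⟩⟩
      have hx' : x ∈ Submodule.span ℂ (Set.range (cupPowOne ℂ (ComplexPoints A.X) 0)) := by
        rw [htop]; exact Submodule.mem_top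
      rw [hrange] at hx'
      refine Submodule.span_mono (fun c hc => ?_) hx'
      rw [Set.mem_singleton_iff] at hc
      exact mem_divisorMonomials_zero.2 hc
    · haveI : Subsingleton (complexBetti A.X (2 * p)) :=
        hX.subsingleton_of_lt (by rw [AbelianVariety.finrank_complexBetti_one]; omega)
      rw [Subsingleton.elim x 0]
      exact Submodule.zero_mem _
  -- positive dimension: `x` is `S(A)(ℂ)`-invariant by Thm. 4.4
  obtain ⟨s, hs, hKs⟩ := hK
  have hnd := eq_zero_of_forall_polarizationPairingOne_eq_zero_of_isKaehlerClass_smul' hs.ne' hKs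
  have hh : h ∈ hodgeClassSpan A.dim A.X 1 := mem_hodgeClassSpan_one_of_isKaehlerClass_smul hQ hs.ne' hKs
  have htopne : lefschetzPow h (A.dim - 1) 2 h ≠ 0 := lefschetzPow_self_ne_zero_of_isKaehlerClass_smul hA0 hKs
  have hx' : ∀ u ∈ unitaryCentralizerGroup A h, exteriorPullback hX
      (u : complexBetti A.X 1 →ₗ[ℂ] complexBetti A.X 1) (2 * p) x = x := fun u hu =>
    hx _ (exteriorPullbackEquiv_mem_specialLefschetzGroup hA0 hh htopne hnd hu)
  exact mem_divisorClassesSpan_of_forall_exteriorPullback_eq_of_adjoint φ hC hdiag hQ ⟨s, hs, hKs⟩ J' hJ' hJQ p x hx'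

/-- **Cor. 4.5 as an equality of sets, for one generator with a Rosati partner**: the
`S(A)`-invariants of `H^{2p}(A(ℂ); ℂ)` are EXACTLY `Dᵖ_hom(A)_ℂ` (the converse inclusion is
definitional, `apply_eq_self_of_mem_specialLefschetzGroup`). [cite: Milne1999LefschetzClasses, Cor. 4.5 (p. 659)] -/
theorem setOf_forall_apply_eq_self_eq_divisorClassesSpan_of_adjoint (φ : A ⟶ A)
    (hC : centralizerAlgebra A = Subalgebra.centralizer ℂ {pullbackOne A φ})
    (hdiag : ⨆ μ : ℂ, Module.End.eigenspace (pullbackOne A φ) μ = ⊤)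
    {h : complexBetti A.X 2} (hQ : IsRationalClass h)
    (hK : ∃ s : ℝ, 0 < s ∧ IsKaehlerClass A.dim A.X ((s : ℂ) • h))
    (J' : Module.End ℂ (complexBetti A.X 1))
    (hJ' : J' ∈ Subalgebra.centralizer ℂ (centralizerAlgebra A : Set (Module.End ℂ (complexBetti A.X 1))))
    (hJQ : ∀ x y : complexBetti A.X 1,
      polarizationPairingOne A.X h (A.dim - 1) (pullbackOne A φ x) y =
        polarizationPairingOne A.X h (A.dim - 1) x (J' y)) (p : ℕ) :
    {x : complexBetti A.X (2 * p) | ∀ g ∈ specialLefschetzGroup A.dim A.X, g (2 * p) x = x} =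
      (divisorClassesSpan A.X A.dim p : Set _) :=
  Set.Subset.antisymm
    (fun x hx => specialLefschetzGroup_invariants_le_of_adjoint φ hC hdiag hQ hK J' hJ' hJQ p x hx)
    fun _ hx _ hg => apply_eq_self_of_mem_specialLefschetzGroup hg hx

/-- **Milne Prop. 4.8, (c) ⇒ (a) on `A` itself, unconditionally for one generator with a Rosati
partner**: if `Hg′(A) = S(A)` then every rational `(p,p)`-class of `A` is fixed by `S(A)`, hence lies in
`Dᵖ ⊗ ℂ` — `IsDivisorGenerated A`. [cite: Milne1999LefschetzClasses, Prop. 4.8 and Cor. 4.5 (pp. 659–660)] -/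
theorem isDivisorGenerated_of_hodgeGroup_eq_specialLefschetzGroup_of_adjoint (φ : A ⟶ A)
    (hC : centralizerAlgebra A = Subalgebra.centralizer ℂ {pullbackOne A φ})
    (hdiag : ⨆ μ : ℂ, Module.End.eigenspace (pullbackOne A φ) μ = ⊤)
    {h : complexBetti A.X 2} (hQ : IsRationalClass h)
    (hK : ∃ s : ℝ, 0 < s ∧ IsKaehlerClass A.dim A.X ((s : ℂ) • h))
    (J' : Module.End ℂ (complexBetti A.X 1))
    (hJ' : J' ∈ Subalgebra.centralizer ℂ (centralizerAlgebra A : Set (Module.End ℂ (complexBetti A.X 1))))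
    (hJQ : ∀ x y : complexBetti A.X 1,
      polarizationPairingOne A.X h (A.dim - 1) (pullbackOne A φ x) y =
        polarizationPairingOne A.X h (A.dim - 1) x (J' y))
    (hHg : hodgeGroup A.dim A.X = specialLefschetzGroup A.dim A.X) : IsDivisorGenerated A :=
  fun p c hc hpp => specialLefschetzGroup_invariants_le_of_adjoint φ hC hdiag hQ hK J' hJ' hJQ p c
    fun _ hg => apply_eq_self_of_mem_hodgeGroup (hHg ▸ hg) hc hpp

/-- **The Rosati form**: for `φ, ψ ∈ End(A)` with `Q_h(φ^*x, y) = Q_h(x, ψ^*y)` (`ψ = φ†`), `φ^*`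
diagonalisable on `H¹(A(ℂ); ℂ)` and `C(A) ⊗ ℂ` the commutant of `φ^*` — simple abelian varieties of
type I (`ψ = φ`, `End⁰(A) = ℚ(φ)` totally real) or of type IV with `End⁰(A) = ℚ(φ)` a CM field
(`ψ = φ̄`) — the `S(A)`-invariants of `H^{2p}(A(ℂ); ℂ)` lie in `Dᵖ_hom(A)_ℂ`.
[cite: Milne1999LefschetzClasses, §2 pp. 645–650 (types I, IV), Thm. 3.2, Cor. 4.5]
[cite: LangeBirkenhake1992, §5.1 (Rosati involution) and Thm. 5.5.6] -/
theorem specialLefschetzGroup_invariants_le_of_rosati (φ ψ : A ⟶ A)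
    (hC : centralizerAlgebra A = Subalgebra.centralizer ℂ {pullbackOne A φ})
    (hdiag : ⨆ μ : ℂ, Module.End.eigenspace (pullbackOne A φ) μ = ⊤)
    {h : complexBetti A.X 2} (hQ : IsRationalClass h)
    (hK : ∃ s : ℝ, 0 < s ∧ IsKaehlerClass A.dim A.X ((s : ℂ) • h))
    (hJQ : ∀ x y : complexBetti A.X 1,
      polarizationPairingOne A.X h (A.dim - 1) (pullbackOne A φ x) y =
        polarizationPairingOne A.X h (A.dim - 1) x (pullbackOne A ψ y))
    (p : ℕ) (x : complexBetti A.X (2 * p)) (hx : ∀ g ∈ specialLefschetzGroup A.dim A.X, g (2 * p) x = x) :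
    x ∈ divisorClassesSpan A.X A.dim p :=
  specialLefschetzGroup_invariants_le_of_adjoint φ hC hdiag hQ hK (pullbackOne A ψ)
    (pullbackOne_mem_centralizer_centralizerAlgebra ψ) hJQ p x hx

/-- **Milne Prop. 4.8, (c) ⇒ (a), Rosati form**: `Hg′(A) = S(A)` and the hypotheses of
`specialLefschetzGroup_invariants_le_of_rosati` give `IsDivisorGenerated A`.
[cite: Milne1999LefschetzClasses, Prop. 4.8 and Cor. 4.5 (pp. 659–660)] -/
theorem isDivisorGenerated_of_hodgeGroup_eq_specialLefschetzGroup_of_rosati (φ ψ : A ⟶ A)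
    (hC : centralizerAlgebra A = Subalgebra.centralizer ℂ {pullbackOne A φ})
    (hdiag : ⨆ μ : ℂ, Module.End.eigenspace (pullbackOne A φ) μ = ⊤)
    {h : complexBetti A.X 2} (hQ : IsRationalClass h)
    (hK : ∃ s : ℝ, 0 < s ∧ IsKaehlerClass A.dim A.X ((s : ℂ) • h))
    (hJQ : ∀ x y : complexBetti A.X 1,
      polarizationPairingOne A.X h (A.dim - 1) (pullbackOne A φ x) y =
        polarizationPairingOne A.X h (A.dim - 1) x (pullbackOne A ψ y))
    (hHg : hodgeGroup A.dim A.X = specialLefschetzGroup A.dim A.X) : IsDivisorGenerated A :=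
  isDivisorGenerated_of_hodgeGroup_eq_specialLefschetzGroup_of_adjoint φ hC hdiag hQ hK (pullbackOne A ψ)
    (pullbackOne_mem_centralizer_centralizerAlgebra ψ) hJQ hHg

end Main

end Literature.AlgebraicGeometry.Milne1999

end
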